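import Summits.QuantumFields.BalabanUV.Beta.FP.NearRegionCrossBubble

/-!
# `BalabanUV.Beta.FP.NearRegionCrossBubbleTwins` — road «FP» (binder row D1), organisation β of `RHOA-DESIGN.md` §3, row RHOA-3 (N-PC generic), PART 2b:
# THE `(R′,R)` TWIN (both legs two-point: pointwise `≤ 16(B₂′B₀ + 2B₁′B₁ + B₀′B₂)·(C₀Θ₁)(C₁Θ₁)`, window `n⁻⁶·n⁶`) AND THE TADPOLE TWIN
# ([folklore] lattice bookkeeping on `ℤ⁴`; nothing of the manuscripts; no road object is typed or touched)

HONEST DEPENDENCY (page 1, mandatory): continuum YM on T⁴ ⇐ BetaPertH ∧ nine spine estimates (0/9 proved); BetaPertH ⇐ (D1) ∧ (D4) ∧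
CAP+tail; G-an2-4 gates asym, D1 and NE2/3/4.  HONEST FRAMING (cell contract, verbatim): «discharging `BetaPertH` makes Bałaban's UV
stability UNCONDITIONAL — a real constructive-QFT result; it is NOT the continuum limit and NOT the Clay problem.»  THIS MODULE assembles BY NAME PART 1a∕1b
(`FP/NearRegionCrossBubble{Letters,Smear}`: the two-point path letters `abs_sub_fst_le`∕`abs_sub_snd_le`∕`abs_mixedDiff₂_le`, the identity `tsum_cross₂_eq_tsum_mixed`,
`mixed_split₂`, `abs_tsum_cross_le_of_pow`) and PART 2a's shell calculus (`sum_annulus_le_of_shell_bound`, `sum_range_succ_pow_le`).  Every analytic input is a HYPOTHESIS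
displayed in the signatures; the module cites nothing, defines nothing, mints no `Prop` fact, 0 sorry.  NOT the road's `R^Q`∕`R^g`∕`Ḣ`∕quartic table (RHOA-8
instantiates), NOT `ρ_n` bounded, NOT `hasym`, NOT D1, NOT BetaPertH, NOT continuum, NOT Clay.

ROW (road FP owner d1-p3-g6, `RHOA-DESIGN.md` 7feeae18441b23f4 §3 (N-PC) ∕ §5 RHOA-3, `LEAVES-FP.md` l.309; R-FP-22 (a)): «`|bubble(R_n,R_n)(z)| ≤ Cn⁻⁶` …
`Σ_{‖z‖≤n}‖z‖²·(…) ≤ C·n⁻⁶·n⁶`; `tadpole(R_n)` twin».  OBJECTS (scalar fibre, relative coordinates at the vertex at `z`):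
`X₂(z) = Σ'_{q=((y,u),(w′,x′))} c₀ (y,u)·c₁ (w′,x′)·R′ (z+x′) y·R u (z+w′)` and `T(z) = Σ'_{p=(w,x′)} c p·R (z+x′) w`.

CONTENT ([folklore]; `Θ_m := 2^{m+1}(m!e^{δ/2}(2/δ)^m)e^{δ/2}Zl 4 (δ/2)²`: `Θ₀ = 2e^{δ/2}e^{δ/2}Zl²`, `Θ₁ = 4e^{δ/2}(2/δ)e^{δ/2}Zl²`, written out).
* §3 `abs_mixed_integrand₂_le` (the doubly-subtracted `(R′,R)` integrand `≤ 16(B₂′B₀ + 2B₁′B₁ + B₀′B₂)·L(q.1)·L(q.2)`), **`abs_cross₂_le`** (two ZERO-MASS weights, GLOBAL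
  letters of both legs ⟹ `|X₂(z)| ≤ 16(B₂′B₀ + 2B₁′B₁ + B₀′B₂)·(C₀Θ₁)(C₁Θ₁)` for EVERY `z`, no decay needed), **`sum_annulus_sq_mul_abs_cross₂_le`** (scale-`n` letters
  `B′/n^{2+j}`, `B/n^{2+j}`, `1 ≤ n` ⟹ `Σ_{annulus 4 0 n}‖z‖∞²·|X₂(z)| ≤ 80·(64·B′B)·(C₀Θ₁)(C₁Θ₁)` — `n⁻⁶·n⁶`).
* §4 THE TADPOLE TWIN (honest shape): `abs_tadpoleSmear_le` (`|T(z)| ≤ B₀·(C·Θ₀)`), `abs_tadpoleSmear_le_of_zero_mass` (`Σ'c = 0`, first-difference letters `B₁` ⟹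
  `≤ 4B₁·(C·Θ₁)`).  BiLoc ALONE gives no decay in `z` for a power-law leg: the vertex's own `e^{−δ′‖z‖}` (H2V-DESIGN §2 «tadpoles O(e^{−δ‖z‖})») enters through the
  consumer's localisation constant `C = C(z)`, displayed, not derived here; the window sum is then the consumer's `TailShellBound`-type shell sum.
Unit `b2b-balaban-gan24-formalise-leaf-05` (gen 36; cross-lane idle G-an2-4 swarm leaf seat on road FP), 2026-08-21; journal INTENT ∕ CLAIM «RHOA-3» l.23369.
-/

noncomputable section

namespace Summit.QuantumFields.BalabanUV.Beta.FP.NearRegionCrossBubbleTwins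

open Finset Filter Topology fwdDiff
open scoped BigOperators
open Literature.Probability.LatticeModels (annulus)
open Literature.MathematicalPhysics.QuantumFieldTheory.Balaban1983to89
open Literature.MathematicalPhysics.QuantumFieldTheory.Balaban1983to89.Beta
open B12Sec2to5 (l1 l1_nonneg)
open ExpKernelCalculus (Site Zl Zl_pos l1_sub_symm)
open WindowLog (shellSum)
open TransferUV (card_annulus_succ_four_le)
open DyadicShell (Pt supNorm supNorm_eq_zero_iff supNorm_eq_of_mem_sphere sum_Ico_shellSum)
open Summit.QuantumFields.BalabanUV.Beta.FP.ExpLocalisedBubble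
open Summit.QuantumFields.BalabanUV.Beta.FP.ExpLocalisedBubblePoint (nonneg_of_decay_pow)
open Summit.QuantumFields.BalabanUV.Beta.FP.NearRegionCrossBubbleLetters
open Summit.QuantumFields.BalabanUV.Beta.FP.NearRegionCrossBubbleSmear
open Summit.QuantumFields.BalabanUV.Beta.FP.NearRegionCrossBubblePoint
open Summit.QuantumFields.BalabanUV.Beta.FP.NearRegionCrossBubble

/-! ## §3 The `(R′,R)` twin: both legs two-point with global letters -/

section RR

variable {c₀ c₁ : Pt × Pt → ℝ} {R' R : Pt → Pt → ℝ} {C₀ C₁ δ B₀' B₁' B₂' B₀ B₁ B₂ B' B : ℝ} {n : ℕ}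

/-- [folklore] THE DOUBLY-SUBTRACTED `(R′,R)` INTEGRAND IS BOUNDED BY THE LETTERS (no decay in `z`): for every `z` and `q = ((y,u),(w′,x′))`,
`|Φ_z q| ≤ 16·(B₂′B₀ + 2B₁′B₁ + B₀′B₂)·L(q.1)·L(q.2)` (T1: MIXED letter of `R′` × size of `R`; T2∕T3: first × first; T4: size of `R′` × MIXED letter of `R`). -/
theorem abs_mixed_integrand₂_le
    (hR0' : ∀ x y, |R' x y| ≤ B₀')
    (hR1'' : ∀ (x y : Pt) (j : Fin 4), |R' x (y + Pi.single j 1) - R' x y| ≤ B₁')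
    (hR1' : ∀ (x y : Pt) (i : Fin 4), |R' (x + Pi.single i 1) y - R' x y| ≤ B₁')
    (hR2' : ∀ (x y : Pt) (i j : Fin 4),
      |R' (x + Pi.single i 1) (y + Pi.single j 1) - R' x (y + Pi.single j 1) - R' (x + Pi.single i 1) y + R' x y| ≤ B₂')
    (hR0 : ∀ u w, |R u w| ≤ B₀)
    (hR1 : ∀ (u w : Pt) (i : Fin 4), |R (u + Pi.single i 1) w - R u w| ≤ B₁)
    (hR1s : ∀ (u w : Pt) (j : Fin 4), |R u (w + Pi.single j 1) - R u w| ≤ B₁)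
    (hR2 : ∀ (u w : Pt) (i j : Fin 4),
      |R (u + Pi.single i 1) (w + Pi.single j 1) - R u (w + Pi.single j 1) - R (u + Pi.single i 1) w + R u w| ≤ B₂)
    (z : Pt) (q : (Pt × Pt) × (Pt × Pt)) :
    |R' (z + q.2.2) q.1.1 * R q.1.2 (z + q.2.1) - R' (z + q.2.2) 0 * R 0 (z + q.2.1) - R' z q.1.1 * R q.1.2 z + R' z 0 * R 0 z|
      ≤ 16 * (B₂' * B₀ + 2 * (B₁' * B₁) + B₀' * B₂)
        * ((l1 q.1.1 + 1) + (l1 q.1.2 + 1)) ^ 1 * ((l1 q.2.1 + 1) + (l1 q.2.2 + 1)) ^ 1 := by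
  obtain ⟨⟨y, u⟩, ⟨w', x'⟩⟩ := q
  simp only [pow_one]
  have hB0' : 0 ≤ B₀' := (abs_nonneg _).trans (hR0' 0 0)
  have hB1' : 0 ≤ B₁' := (abs_nonneg _).trans (hR1' 0 0 0)
  have hB2' : 0 ≤ B₂' := (abs_nonneg _).trans (hR2' 0 0 0 0)
  have hB0 : 0 ≤ B₀ := (abs_nonneg _).trans (hR0 0 0)
  have hB1 : 0 ≤ B₁ := (abs_nonneg _).trans (hR1 0 0 0)
  have hB2 : 0 ≤ B₂ := (abs_nonneg _).trans (hR2 0 0 0 0)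
  set L₀ : ℝ := (l1 y + 1) + (l1 u + 1) with hL₀
  set L₁ : ℝ := (l1 w' + 1) + (l1 x' + 1) with hL₁
  have hy0 := l1_nonneg y; have hu0 := l1_nonneg u; have hw0 := l1_nonneg w'; have hx0 := l1_nonneg x'
  have hyL : l1 y ≤ L₀ := by rw [hL₀]; linarith
  have huL : l1 u ≤ L₀ := by rw [hL₀]; linarith
  have hwL : l1 w' ≤ L₁ := by rw [hL₁]; linarith
  have hxL : l1 x' ≤ L₁ := by rw [hL₁]; linarith
  have hL₀0 : 0 ≤ L₀ := hy0.trans hyL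
  have hL₁0 : 0 ≤ L₁ := hw0.trans hwL
  have e4 : ((4 : ℕ) : ℝ) = 4 := by norm_num
  -- T1: the mixed letter of `R′` (read through `S a b := R′ (z + b) a`)
  have hT1 : |(R' (z + x') y - R' (z + x') 0 - R' z y + R' z 0) * R u (z + w')| ≤ 16 * (B₂' * B₀) * (L₀ * L₁) := by
    have h := abs_mixedDiff₂_le (D := 4) (R := fun a b => R' (z + b) a) hB2' (fun a b i j => by
      have h' := hR2' (z + b) a j i
      have e : R' (z + (b + Pi.single j 1)) (a + Pi.single i 1) - R' (z + (b + Pi.single j 1)) a - R' (z + b) (a + Pi.single i 1) + R' (z + b) a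
          = R' (z + b + Pi.single j 1) (a + Pi.single i 1) - R' (z + b) (a + Pi.single i 1) - R' (z + b + Pi.single j 1) a + R' (z + b) a := by
        rw [← add_assoc]; ring
      rw [e]; exact h') y 0 x'
    simp only [zero_add, add_zero, e4] at h
    rw [abs_mul]
    calc |R' (z + x') y - R' (z + x') 0 - R' z y + R' z 0| * |R u (z + w')| ≤ (4 * l1 y * (4 * l1 x' * B₂')) * B₀ :=
          mul_le_mul h (hR0 _ _) (abs_nonneg _) (by positivity)
      _ = 16 * (B₂' * B₀) * (l1 y * l1 x') := by ring
      _ ≤ 16 * (B₂' * B₀) * (L₀ * L₁) := mul_le_mul_of_nonneg_left (mul_le_mul hyL hxL hx0 hL₀0) (by positivity)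
  -- T2
  have hT2 : |(R' z y - R' z 0) * (R u (z + w') - R u z)| ≤ 16 * (B₁' * B₁) * (L₀ * L₁) := by
    have h1 := abs_sub_snd_le (D := 4) hB1' hR1'' z 0 y
    rw [zero_add, e4] at h1
    have h2 := abs_sub_snd_le (D := 4) hB1 hR1s u z w'
    rw [e4] at h2
    rw [abs_mul]
    calc |R' z y - R' z 0| * |R u (z + w') - R u z| ≤ (4 * B₁' * l1 y) * (4 * B₁ * l1 w') := mul_le_mul h1 h2 (abs_nonneg _) (by positivity)
      _ = 16 * (B₁' * B₁) * (l1 y * l1 w') := by ring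
      _ ≤ 16 * (B₁' * B₁) * (L₀ * L₁) := mul_le_mul_of_nonneg_left (mul_le_mul hyL hwL hw0 hL₀0) (by positivity)
  -- T3
  have hT3 : |(R' (z + x') 0 - R' z 0) * (R u (z + w') - R 0 (z + w'))| ≤ 16 * (B₁' * B₁) * (L₀ * L₁) := by
    have h1 := abs_sub_fst_le (D := 4) (R := fun a b => R' (z + a) b) hB1' (fun a b i => by
      have h' := hR1' (z + a) b i
      rwa [add_assoc] at h') x' 0
    simp only [add_zero, e4] at h1
    have h2 := abs_sub_fst_le (D := 4) hB1 hR1 u (z + w')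
    rw [e4] at h2
    rw [abs_mul]
    calc |R' (z + x') 0 - R' z 0| * |R u (z + w') - R 0 (z + w')| ≤ (4 * B₁' * l1 x') * (4 * B₁ * l1 u) :=
          mul_le_mul h1 h2 (abs_nonneg _) (by positivity)
      _ = 16 * (B₁' * B₁) * (l1 u * l1 x') := by ring
      _ ≤ 16 * (B₁' * B₁) * (L₀ * L₁) := mul_le_mul_of_nonneg_left (mul_le_mul huL hxL hx0 hL₀0) (by positivity)
  -- T4
  have hT4 : |R' z 0 * (R u (z + w') - R 0 (z + w') - R u z + R 0 z)| ≤ 16 * (B₀' * B₂) * (L₀ * L₁) := by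
    have h := abs_mixedDiff₂_le (D := 4) hB2 hR2 u z w'
    rw [e4] at h
    rw [abs_mul]
    calc |R' z 0| * |R u (z + w') - R 0 (z + w') - R u z + R 0 z| ≤ B₀' * (4 * l1 u * (4 * l1 w' * B₂)) :=
          mul_le_mul (hR0' _ _) h (abs_nonneg _) hB0'
      _ = 16 * (B₀' * B₂) * (l1 u * l1 w') := by ring
      _ ≤ 16 * (B₀' * B₂) * (L₀ * L₁) := mul_le_mul_of_nonneg_left (mul_le_mul huL hwL hw0 hL₀0) (by positivity)
  rw [mixed_split₂]
  have hsum := (abs_add_le _ _).trans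
    (add_le_add ((abs_add_le _ _).trans (add_le_add ((abs_add_le _ _).trans (add_le_add hT1 hT2)) hT3)) hT4)
  refine hsum.trans (le_of_eq ?_)
  ring

/-- [folklore] **THE `(R′,R)` BUBBLE, POINTWISE, NO DECAY NEEDED**: two localised ZERO-MASS weights, legs `R′` (from `x = z+x′` to `y`) and `R` (from `u` to `w = z+w′`)
with GLOBAL letters (size, unit first differences in either argument, MIXED unit second differences) ⟹ for EVERY `z ∈ ℤ⁴`,
`|Σ' c₀ q.1·c₁ q.2·R′ (z+x′) y·R u (z+w′)| ≤ 16·(B₂′B₀ + 2B₁′B₁ + B₀′B₂)·(C₀Θ₁)(C₁Θ₁)`. -/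
theorem abs_cross₂_le (hδ : 0 < δ)
    (hc₀ : ∀ p : Pt × Pt, |c₀ p| ≤ C₀ * (Real.exp (-δ * l1 p.1) * Real.exp (-δ * l1 p.2)))
    (hc₁ : ∀ p : Pt × Pt, |c₁ p| ≤ C₁ * (Real.exp (-δ * l1 p.1) * Real.exp (-δ * l1 p.2)))
    (h0 : ∑' p : Pt × Pt, c₀ p = 0) (h1 : ∑' p : Pt × Pt, c₁ p = 0)
    (hR0' : ∀ x y, |R' x y| ≤ B₀')
    (hR1'' : ∀ (x y : Pt) (j : Fin 4), |R' x (y + Pi.single j 1) - R' x y| ≤ B₁')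
    (hR1' : ∀ (x y : Pt) (i : Fin 4), |R' (x + Pi.single i 1) y - R' x y| ≤ B₁')
    (hR2' : ∀ (x y : Pt) (i j : Fin 4),
      |R' (x + Pi.single i 1) (y + Pi.single j 1) - R' x (y + Pi.single j 1) - R' (x + Pi.single i 1) y + R' x y| ≤ B₂')
    (hR0 : ∀ u w, |R u w| ≤ B₀)
    (hR1 : ∀ (u w : Pt) (i : Fin 4), |R (u + Pi.single i 1) w - R u w| ≤ B₁)
    (hR1s : ∀ (u w : Pt) (j : Fin 4), |R u (w + Pi.single j 1) - R u w| ≤ B₁)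
    (hR2 : ∀ (u w : Pt) (i j : Fin 4),
      |R (u + Pi.single i 1) (w + Pi.single j 1) - R u (w + Pi.single j 1) - R (u + Pi.single i 1) w + R u w| ≤ B₂)
    (z : Pt) :
    |∑' q : (Pt × Pt) × (Pt × Pt), c₀ q.1 * c₁ q.2 * (R' (z + q.2.2) q.1.1 * R q.1.2 (z + q.2.1))|
      ≤ 16 * (B₂' * B₀ + 2 * (B₁' * B₁) + B₀' * B₂)
        * ((C₀ * (4 * Real.exp (δ / 2) * (2 / δ) * Real.exp (δ / 2) * Zl 4 (δ / 2) ^ 2))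
          * (C₁ * (4 * Real.exp (δ / 2) * (2 / δ) * Real.exp (δ / 2) * Zl 4 (δ / 2) ^ 2))) := by
  have hB0' : 0 ≤ B₀' := (abs_nonneg _).trans (hR0' 0 0)
  have hB1' : 0 ≤ B₁' := (abs_nonneg _).trans (hR1' 0 0 0)
  have hB2' : 0 ≤ B₂' := (abs_nonneg _).trans (hR2' 0 0 0 0)
  have hB0 : 0 ≤ B₀ := (abs_nonneg _).trans (hR0 0 0)
  have hB1 : 0 ≤ B₁ := (abs_nonneg _).trans (hR1 0 0 0)
  have hB2 : 0 ≤ B₂ := (abs_nonneg _).trans (hR2 0 0 0 0)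
  rw [tsum_cross₂_eq_tsum_mixed (D := 4) hδ hc₀ hc₁ h0 h1 hR0' hR0 z]
  have h := abs_tsum_cross_le_of_pow (D := 4) hδ hc₀ hc₁ (by positivity) 1
    (fun q => abs_mixed_integrand₂_le hR0' hR1'' hR1' hR2' hR0 hR1 hR1s hR2 z q)
  have hf : (((1 : ℕ).factorial : ℕ) : ℝ) = 1 := by norm_num
  rw [hf] at h
  refine h.trans (le_of_eq ?_)
  ring

/-- [folklore] **THE `(R′,R)` WINDOW SUM AT THE SCALE-`n` LETTERS IS O(1)** (`n⁻⁶·n⁶`): letters `B′/n^{2+j}` of `R′` and `B/n^{2+j}` of `R` (`1 ≤ n`) ⟹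
`Σ_{z ∈ annulus 4 0 n} ‖z‖∞²·|X₂(z)| ≤ 80·(64·(B′·B))·(C₀Θ₁)(C₁Θ₁)`. -/
theorem sum_annulus_sq_mul_abs_cross₂_le (hδ : 0 < δ)
    (hc₀ : ∀ p : Pt × Pt, |c₀ p| ≤ C₀ * (Real.exp (-δ * l1 p.1) * Real.exp (-δ * l1 p.2)))
    (hc₁ : ∀ p : Pt × Pt, |c₁ p| ≤ C₁ * (Real.exp (-δ * l1 p.1) * Real.exp (-δ * l1 p.2)))
    (h0 : ∑' p : Pt × Pt, c₀ p = 0) (h1 : ∑' p : Pt × Pt, c₁ p = 0)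
    (hn : 1 ≤ n)
    (hR0' : ∀ x y, |R' x y| ≤ B' / (n : ℝ) ^ 2)
    (hR1'' : ∀ (x y : Pt) (j : Fin 4), |R' x (y + Pi.single j 1) - R' x y| ≤ B' / (n : ℝ) ^ 3)
    (hR1' : ∀ (x y : Pt) (i : Fin 4), |R' (x + Pi.single i 1) y - R' x y| ≤ B' / (n : ℝ) ^ 3)
    (hR2' : ∀ (x y : Pt) (i j : Fin 4),
      |R' (x + Pi.single i 1) (y + Pi.single j 1) - R' x (y + Pi.single j 1) - R' (x + Pi.single i 1) y + R' x y| ≤ B' / (n : ℝ) ^ 4)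
    (hR0 : ∀ u w, |R u w| ≤ B / (n : ℝ) ^ 2)
    (hR1 : ∀ (u w : Pt) (i : Fin 4), |R (u + Pi.single i 1) w - R u w| ≤ B / (n : ℝ) ^ 3)
    (hR1s : ∀ (u w : Pt) (j : Fin 4), |R u (w + Pi.single j 1) - R u w| ≤ B / (n : ℝ) ^ 3)
    (hR2 : ∀ (u w : Pt) (i j : Fin 4),
      |R (u + Pi.single i 1) (w + Pi.single j 1) - R u (w + Pi.single j 1) - R (u + Pi.single i 1) w + R u w| ≤ B / (n : ℝ) ^ 4) :
    ∑ z ∈ annulus 4 0 n, (supNorm z : ℝ) ^ 2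
        * |∑' q : (Pt × Pt) × (Pt × Pt), c₀ q.1 * c₁ q.2 * (R' (z + q.2.2) q.1.1 * R q.1.2 (z + q.2.1))|
      ≤ 80 * (64 * (B' * B))
        * ((C₀ * (4 * Real.exp (δ / 2) * (2 / δ) * Real.exp (δ / 2) * Zl 4 (δ / 2) ^ 2))
          * (C₁ * (4 * Real.exp (δ / 2) * (2 / δ) * Real.exp (δ / 2) * Zl 4 (δ / 2) ^ 2))) := by
  have hC₀ := nonneg_of_loc hc₀
  have hC₁ := nonneg_of_loc hc₁
  have hnpos : (0 : ℝ) < n := by exact_mod_cast hn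
  have hZ : 0 < Zl 4 (δ / 2) := Zl_pos (half_pos hδ)
  set Θ : ℝ := 4 * Real.exp (δ / 2) * (2 / δ) * Real.exp (δ / 2) * Zl 4 (δ / 2) ^ 2 with hΘ
  set W : ℝ := (C₀ * Θ) * (C₁ * Θ) with hW
  have hW0 : 0 ≤ W := by positivity
  set M : ℝ := 16 * (B' / (n : ℝ) ^ 4 * (B / (n : ℝ) ^ 2) + 2 * (B' / (n : ℝ) ^ 3 * (B / (n : ℝ) ^ 3)) + B' / (n : ℝ) ^ 2 * (B / (n : ℝ) ^ 4))
    with hM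
  have hpt : ∀ z : Pt, |∑' q : (Pt × Pt) × (Pt × Pt), c₀ q.1 * c₁ q.2 * (R' (z + q.2.2) q.1.1 * R q.1.2 (z + q.2.1))| ≤ M * W :=
    fun z => abs_cross₂_le hδ hc₀ hc₁ h0 h1 hR0' hR1'' hR1' hR2' hR0 hR1 hR1s hR2 z
  have hM0 : 0 ≤ M := by
    have h := (abs_nonneg _).trans (hpt 0)
    by_contra hneg
    push Not at hneg
    rcases hW0.eq_or_lt with hW' | hW'
    · -- `W = 0`: then every term vanishes anyway; bound `M` from the letters directly
      have hB'0 : 0 ≤ B' / (n : ℝ) ^ 2 := (abs_nonneg _).trans (hR0' 0 0)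
      have hB'1 : 0 ≤ B' / (n : ℝ) ^ 3 := (abs_nonneg _).trans (hR1' 0 0 0)
      have hB'2 : 0 ≤ B' / (n : ℝ) ^ 4 := (abs_nonneg _).trans (hR2' 0 0 0 0)
      have hB0 : 0 ≤ B / (n : ℝ) ^ 2 := (abs_nonneg _).trans (hR0 0 0)
      have hB1 : 0 ≤ B / (n : ℝ) ^ 3 := (abs_nonneg _).trans (hR1 0 0 0)
      have hB2 : 0 ≤ B / (n : ℝ) ^ 4 := (abs_nonneg _).trans (hR2 0 0 0 0)
      have : 0 ≤ M := by rw [hM]; positivity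
      linarith
    · have : M * W < 0 := mul_neg_of_neg_of_pos hneg hW'
      linarith
  set φ : ℕ → ℝ := fun r => ((r : ℝ) + 1) ^ 2 * (M * W) with hφ
  have hφ0 : ∀ r, 0 ≤ φ r := fun r => by rw [hφ]; positivity
  have hg : ∀ (r : ℕ) (w : Pt), w ∈ annulus 4 r (r + 1) →
      (supNorm w : ℝ) ^ 2 * |∑' q : (Pt × Pt) × (Pt × Pt), c₀ q.1 * c₁ q.2 * (R' (w + q.2.2) q.1.1 * R q.1.2 (w + q.2.1))| ≤ φ r := by
    intro r w hw
    have hs : (supNorm w : ℝ) = (r : ℝ) + 1 := by rw [supNorm_eq_of_mem_sphere hw]; push_cast; ring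
    simp only [hφ]
    rw [hs]
    exact mul_le_mul_of_nonneg_left (hpt w) (by positivity)
  refine (sum_annulus_le_of_shell_bound hφ0 hg n).trans ?_
  have e : ∀ r : ℕ, 80 * ((r : ℝ) + 1) ^ 3 * φ r = 80 * (M * W) * ((r : ℝ) + 1) ^ 5 := fun r => by rw [hφ]; ring
  simp_rw [e]
  rw [← Finset.mul_sum]
  calc 80 * (M * W) * ∑ r ∈ Finset.range n, ((r : ℝ) + 1) ^ 5 ≤ 80 * (M * W) * (n : ℝ) ^ (5 + 1) :=
        mul_le_mul_of_nonneg_left (sum_range_succ_pow_le n 5) (by positivity)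
    _ = 80 * (64 * (B' * B)) * W := by
        have hn0 : (n : ℝ) ≠ 0 := hnpos.ne'
        rw [hM]
        field_simp
        ring

end RR

/-! ## §4 The tadpole twin -/

section Tadpole

variable {c : Pt × Pt → ℝ} {R : Pt → Pt → ℝ} {C δ B₀ B₁ : ℝ}

/-- [folklore] **THE TADPOLE SMEAR, NO ZERO MASS**: `T(z) := Σ'_{p=(w,x′)} c p·R (z+x′) w` with `|c p| ≤ C·e^{−δ(|w|₁+|x′|₁)}` and `|R| ≤ B₀` ⟹
`|T(z)| ≤ B₀·(C·Θ₀)`, `Θ₀ = 2·e^{δ/2}·e^{δ/2}·Zl 4 (δ/2)²` (the decay in `z` is the vertex's own letter `C = C(z)`, displayed by the consumer). -/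
theorem abs_tadpoleSmear_le (hδ : 0 < δ) (hc : ∀ p : Pt × Pt, |c p| ≤ C * (Real.exp (-δ * l1 p.1) * Real.exp (-δ * l1 p.2)))
    (hR0 : ∀ u w, |R u w| ≤ B₀) (z : Pt) :
    |∑' p : Pt × Pt, c p * R (z + p.2) p.1| ≤ B₀ * (C * (2 * Real.exp (δ / 2) * Real.exp (δ / 2) * Zl 4 (δ / 2) ^ 2)) := by
  have hB0 : 0 ≤ B₀ := (abs_nonneg _).trans (hR0 0 0)
  have hs := summable_loc_mul_pow hδ hc 0
  have hb := tsum_of_norm_bounded (hs.mul_right B₀).hasSum (f := fun p : Pt × Pt => c p * R (z + p.2) p.1) (fun p => by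
    rw [Real.norm_eq_abs, abs_mul, pow_zero, mul_one]
    exact mul_le_mul_of_nonneg_left (hR0 _ _) (abs_nonneg _))
  rw [Real.norm_eq_abs, tsum_mul_right] at hb
  refine (hb.trans (mul_le_mul_of_nonneg_right (tsum_loc_mul_pow_le hδ hc 0) hB0)).trans (le_of_eq ?_)
  have hf : (((0 : ℕ).factorial : ℕ) : ℝ) = 1 := by norm_num
  rw [hf]
  ring

/-- [folklore] **THE TADPOLE SMEAR WITH ZERO TOTAL MASS GAINS ONE DIFFERENCE**: `Σ'c = 0`, `|c p| ≤ C·e^{−δ(|w|₁+|x′|₁)}`, `|R| ≤ B₀`, GLOBAL unit first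
differences of `R` in either argument `≤ B₁` ⟹ `|T(z)| ≤ 4·B₁·(C·Θ₁)` (`R (z+x′) w − R z 0` along two lattice paths). -/
theorem abs_tadpoleSmear_le_of_zero_mass (hδ : 0 < δ) (hc : ∀ p : Pt × Pt, |c p| ≤ C * (Real.exp (-δ * l1 p.1) * Real.exp (-δ * l1 p.2)))
    (h0 : ∑' p : Pt × Pt, c p = 0) (hR0 : ∀ u w, |R u w| ≤ B₀)
    (hR1 : ∀ (u w : Pt) (i : Fin 4), |R (u + Pi.single i 1) w - R u w| ≤ B₁)
    (hR1s : ∀ (u w : Pt) (j : Fin 4), |R u (w + Pi.single j 1) - R u w| ≤ B₁) (z : Pt) :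
    |∑' p : Pt × Pt, c p * R (z + p.2) p.1| ≤ 4 * B₁ * (C * (4 * Real.exp (δ / 2) * (2 / δ) * Real.exp (δ / 2) * Zl 4 (δ / 2) ^ 2)) := by
  have hB0 : 0 ≤ B₀ := (abs_nonneg _).trans (hR0 0 0)
  have hB1 : 0 ≤ B₁ := (abs_nonneg _).trans (hR1 0 0 0)
  have e4 : ((4 : ℕ) : ℝ) = 4 := by norm_num
  have hw := summable_weight hδ hc
  have hs0 := summable_loc_mul_pow hδ hc 0
  simp only [pow_zero, mul_one] at hs0
  have hS : Summable fun p : Pt × Pt => c p * R (z + p.2) p.1 :=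
    Summable.of_norm_bounded (hs0.mul_right B₀) (fun p => by
      rw [Real.norm_eq_abs, abs_mul]; exact mul_le_mul_of_nonneg_left (hR0 _ _) (abs_nonneg _))
  -- subtract the zero-mass term
  have e : ∑' p : Pt × Pt, c p * R (z + p.2) p.1 = ∑' p : Pt × Pt, c p * (R (z + p.2) p.1 - R z 0) := by
    rw [← sub_zero (∑' p : Pt × Pt, c p * R (z + p.2) p.1), ← zero_mul (R z 0), ← h0, ← tsum_mul_right, ← hS.tsum_sub (hw.mul_right _)]
    exact tsum_congr fun p => by ring
  rw [e]
  have hs1 := summable_loc_mul_pow hδ hc 1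
  have hb := tsum_of_norm_bounded (hs1.mul_right (4 * B₁)).hasSum (f := fun p : Pt × Pt => c p * (R (z + p.2) p.1 - R z 0)) (fun p => by
    rw [Real.norm_eq_abs, abs_mul, pow_one]
    have h1 := abs_sub_fst_le (D := 4) (R := fun a b => R (z + a) b) hB1 (fun a b i => by
      have h' := hR1 (z + a) b i
      rwa [add_assoc] at h') p.2 p.1
    simp only [add_zero, e4] at h1
    have h2 := abs_sub_snd_le (D := 4) hB1 hR1s z 0 p.1
    rw [zero_add, e4] at h2
    have h12 : |R (z + p.2) p.1 - R z 0| ≤ 4 * B₁ * ((l1 p.1 + 1) + (l1 p.2 + 1)) := by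
      have := l1_nonneg p.1; have := l1_nonneg p.2
      calc |R (z + p.2) p.1 - R z 0| ≤ |R (z + p.2) p.1 - R z p.1| + |R z p.1 - R z 0| := abs_sub_le _ _ _
        _ ≤ 4 * B₁ * l1 p.2 + 4 * B₁ * l1 p.1 := add_le_add h1 h2
        _ ≤ 4 * B₁ * ((l1 p.1 + 1) + (l1 p.2 + 1)) := by nlinarith
    calc |c p| * |R (z + p.2) p.1 - R z 0| ≤ |c p| * (4 * B₁ * ((l1 p.1 + 1) + (l1 p.2 + 1))) :=
          mul_le_mul_of_nonneg_left h12 (abs_nonneg _)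
      _ = |c p| * ((l1 p.1 + 1) + (l1 p.2 + 1)) * (4 * B₁) := by ring)
  rw [Real.norm_eq_abs, tsum_mul_right] at hb
  have h4B : (0 : ℝ) ≤ 4 * B₁ := by positivity
  refine (hb.trans (mul_le_mul_of_nonneg_right (tsum_loc_mul_pow_le hδ hc 1) h4B)).trans (le_of_eq ?_)
  have hf : (((1 : ℕ).factorial : ℕ) : ℝ) = 1 := by norm_num
  rw [hf]
  ring

end Tadpole

end Summit.QuantumFields.BalabanUV.Beta.FP.NearRegionCrossBubbleTwins

end
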